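import Literature.MathematicalPhysics.QuantumFieldTheory.Balaban1983to89.MatrixNorms

/-!
# `Balaban1983to89.B12GaugeFixExpansion25` — T. Bałaban, *Renormalization group approach to lattice gauge field
theories. I*, Commun. Math. Phys. **109** (1987) 249–301 [Balaban1987RG1]: the second-order expansion (2.5) p. 266 of
the exponential gauge-fixing term `G(V′V⁽ᵏ⁾)` around the minimum `V⁽ᵏ⁾`, TYPED AND PROVED

statement-level skeleton of published theorems with citation tags; proofs where landed; nothing here is a claim about the Yang–Mills mass gap

PDF held: `paper:balaban1987-cmp109-rg-i-small-field` (journal page = PDF page + 248; displays read from the page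
renders `b2b-balaban-ref1/pages/1987-cmp109-rg-I-small-field/…-p017-x4.png`, `…-p018-x4.png`).
WHAT IS REPRODUCED: SKELETON row `B12.Eq2.5` of the cell `lit-balaban` (Phase-2 seat p08, HOME
`run/shared/lean/pub/lit-balaban/lit-balaban-p08/`).

THE PRINT.  p. 265 [PDF 17]: *«… choosing the element of the orbit satisfying the axial gauge conditions G(V) = 0.
This critical configuration, which is a minimum of the function (2.2), is denoted by V⁽ᵏ⁾ …»*; *«We introduce new
integration variables V′ = V(V⁽ᵏ⁾)⁻¹, or V = V′V⁽ᵏ⁾, and we assume that [χ_k and the δ-functions] restrict the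
variables B′ = (1/i) log V′ to a sufficiently small neighborhood of 0.»*  p. 266 [PDF 18], verbatim: *«The gauge
fixing term under the exponential in (2.1) is equal to G(V′V⁽ᵏ⁾) = G(Ṽ′) = G(B′). The variables
Ṽ′(y, x) = (V′V⁽ᵏ⁾)(y, x) (V⁽ᵏ⁾(y, x))⁻¹ have an expansion of the form Ṽ′(y, x) = 1 + B̃′(y, x) + …, where
B̃′(y, x) is a linear function, hence the gauge fixing expression has the representation
  G(B′) = Σ_{y∈T⁽ᵏ⁺¹⁾} Σ_{x∈B(y), x≠y} ½|B̃′(y, x)|² + G₃(B′) = ½G⁽²⁾(B′) + G₃(B′).   (2.5)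
The function G₃(B′) is an analytic function of B′, with an expansion beginning with third order terms, localized in
blocks of the lattice T⁽ᵏ⁾.»*  Here `G(V) = Σ_y Σ_{x∈B(y), x≠y} [1 − Re tr V(y, x)]` is the gauge-fixing function of
(0.17)/(2.1) (`Setup.gaugeFixFn`) and `|·|` is the `L²` matrix norm of [12] p. 21, for which (0.14)
`½|U − 1|² = 1 − Re tr U` holds on all of `U(N)` (`MatrixNorms.nhsNormSq_sub_one_of_mem_unitaryGroup`, the cell's
reading of (0.14) — see the header of `MatrixNorms`).

THE TYPING (over `Setup`: `ContourData.holTo U y x = U(y, x)`, `gaugeFixFn`, `AxialGauge`, `block`, `emb`; unitary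
matrix model `UnitaryModel.nReTr`, `MatrixNorms.nhsNormSq`).  (i) `G` is realised by a unitary representation
`ρ : G →* M_n(ℂ)` with `reTr = Re tr ∘ ρ` (hypotheses `hρU`, `hρtr`; `rfl` for the cell's instances `U(n)`, `SU(n)`,
§ 4).  (ii) `B′` ranges over an arbitrary real normed space `E` (print: `𝔤`-valued bond functions on `T⁽ᵏ⁾`),
`V′V⁽ᵏ⁾` is an arbitrary map `pert : E → GaugeField P k G` with `pert 0 = V⁽ᵏ⁾` (`V′ = exp iB′ = 1` at `B′ = 0`), and
`Ṽ′(y, x)(B′)` is the printed formula (`tildeV`).  (iii) «Ṽ′(y, x) = 1 + B̃′(y, x) + …, B̃′ linear» is read: `B′ ↦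
ρ(Ṽ′(y, x)(B′))` is real-analytic at `0` (hypothesis `han`) and `B̃′(y, x)` IS its Fréchet derivative there
(`Btilde`); `G⁽²⁾` is `G2`; `G₃ := G − ½G⁽²⁾` as the printed block sum is `G3 = Σ_y G3block y`.  (iv) «analytic» is
`AnalyticAt ℝ G₃ 0`; «expansion beginning with third order terms» is `G₃ =O[𝓝 0] ‖B′‖³` (the reading of `D̃₃`, `G₃`
in `B12SecondOrder267`, `B12ZeroCoupling268`); «localized in blocks» is `G3block_local`.  (v) The real normed structure
of `M_n(ℂ)` is the restriction of scalars of the complex one, operator norm of [12] (19) (scope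
`Matrix.Norms.L2Operator`; local instances as in the tree's `CMTorusEigenRows`).
WHAT IS PROVED (kernel, no `sorry`).  § 1 for unitary `U` and ANY matrix `A`: `|[1 − Re tr U] − ½|A|²| ≤
‖A‖‖U − 1 − A‖ + ½‖U − 1 − A‖²` ((0.14) + polarization).  § 2 for a real-analytic germ `W`, `W(0) = 1`, unitary
values: `[1 − Re tr W(x)] − ½|DW(0)x|²` is analytic, `O(‖x‖³)` (Mathlib `HasFPowerSeriesAt.isBigO_sub_partialSum_pow`)
and block-local (`rem3_*`).  § 3 the display: `eq25` (identity, from the axial gauge of `V⁽ᵏ⁾`), `G3_analyticAt`,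
`G3_isBigO`, `G3block_local`, bundled in `eq25_expansion`; dictionary `gaugeFixFn_eq_zero_iff_axialGauge` for p. 265
«the axial gauge conditions G(V) = 0».  § 4 `U(n)`, `SU(n)`.  Not used, not proved: existence/uniqueness of `V⁽ᵏ⁾`
((2.2)–(2.3), `B12SmallFieldDomain259.CriticalPoint23`); analyticity in `B′` of the concrete averages (0.11)–(0.12).
-/

open Filter Asymptotics open scoped Matrix Matrix.Norms.L2Operator Topology

namespace Literature.MathematicalPhysics.QuantumFieldTheory.Balaban1983to89.B12GaugeFixExpansion25

open Literature.MathematicalPhysics.QuantumFieldTheory.Balaban1983to89 UnitaryModel MatrixNorms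

noncomputable section

variable {n : Type*} [Fintype n]

/-- File-local convention (§ (v) of the header): the real vector-space structure of `M_n(ℂ)` is the restriction of
scalars of the complex one (it agrees definitionally, not reducibly, with the entrywise one). [folklore] -/
local instance (priority := high) instModuleRealMatrixComplex : Module ℝ (Matrix n n ℂ) :=
  Module.complexToReal (Matrix n n ℂ)

variable [DecidableEq n]

/-- File-local convention: the real normed-space structure of `M_n(ℂ)`, operator norm. [folklore] -/
local instance (priority := high) instNormedSpaceRealMatrixComplex : NormedSpace ℝ (Matrix n n ℂ) :=
  NormedSpace.complexToReal

/-! ## 1. The matrix inequality behind (2.5): (0.14) plus polarization -/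

omit [DecidableEq n] in
/-- `Re tr` is additive. [folklore] -/
private lemma nReTr_add' (X Y : Matrix n n ℂ) : nReTr (X + Y) = nReTr X + nReTr Y := by
  simp [nReTr, Matrix.trace_add, add_div]

omit [DecidableEq n] in
/-- `|X|² = Re tr X*X` for the `L²` norm of [12] p. 21 (normalized Hilbert–Schmidt norm). [cite: Balaban1985Averaging, (17) p.20] -/
theorem nhsNormSq_eq_nReTr (X : Matrix n n ℂ) : nhsNormSq X = nReTr (Xᴴ * X) := by
  rw [nhsNormSq, sum_norm_sq_eq_re_trace, nReTr]

omit [DecidableEq n] in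
/-- Polarization of the `L²` norm: `|A + R|² = |A|² + Re tr (A*R + R*A + R*R)`. [cite: Balaban1985Averaging, (17) p.20] -/
theorem nhsNormSq_add_eq (A R : Matrix n n ℂ) :
    nhsNormSq (A + R) = nhsNormSq A + nReTr (Aᴴ * R + Rᴴ * A + Rᴴ * R) := by
  rw [nhsNormSq_eq_nReTr, nhsNormSq_eq_nReTr, ← nReTr_add', Matrix.conjTranspose_add, add_mul, mul_add, mul_add]
  congr 1
  abel

/-- The polarization terms in operator norms: `||A + R|² − |A|²| ≤ 2‖A‖‖R‖ + ‖R‖²` (by `|tr X| ≤ ‖X‖`,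
`‖XY‖ ≤ ‖X‖‖Y‖`, `‖X*‖ = ‖X‖` of [12] (20)). [cite: Balaban1985Averaging, (20) p.21] -/
theorem abs_nhsNormSq_add_sub_le (A R : Matrix n n ℂ) :
    |nhsNormSq (A + R) - nhsNormSq A| ≤ 2 * ‖A‖ * ‖R‖ + ‖R‖ ^ 2 := by
  rw [nhsNormSq_add_eq, add_sub_cancel_left]
  have h : ∀ X Y : Matrix n n ℂ, ‖Xᴴ * Y‖ ≤ ‖X‖ * ‖Y‖ :=
    fun X Y => (Matrix.l2_opNorm_mul _ _).trans (by rw [Matrix.l2_opNorm_conjTranspose])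
  calc |nReTr (Aᴴ * R + Rᴴ * A + Rᴴ * R)| ≤ ‖Aᴴ * R + Rᴴ * A + Rᴴ * R‖ := abs_nReTr_le_opNorm _
    _ ≤ ‖Aᴴ * R‖ + ‖Rᴴ * A‖ + ‖Rᴴ * R‖ := norm_add₃_le
    _ ≤ ‖A‖ * ‖R‖ + ‖R‖ * ‖A‖ + ‖R‖ * ‖R‖ := by gcongr <;> exact h _ _
    _ = 2 * ‖A‖ * ‖R‖ + ‖R‖ ^ 2 := by ring

/-- THE INEQUALITY BEHIND (2.5): for a unitary `U` and ANY matrix `A` (the candidate linear term `B̃′`), with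
`R := U − 1 − A` the higher-order part of `Ṽ′ = 1 + B̃′ + …`: `|[1 − Re tr U] − ½|A|²| ≤ ‖A‖‖R‖ + ½‖R‖²`, because
`1 − Re tr U = ½|U − 1|² = ½|A + R|²` by (0.14). [cite: Balaban1987RG1, (2.5) p.266] -/
theorem abs_one_sub_nReTr_sub_half_nhsNormSq_le [Nonempty n] {U : Matrix n n ℂ}
    (hU : U ∈ Matrix.unitaryGroup n ℂ) (A : Matrix n n ℂ) :
    |(1 - nReTr U) - (1 / 2) * nhsNormSq A| ≤ ‖A‖ * ‖U - 1 - A‖ + ‖U - 1 - A‖ ^ 2 / 2 := by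
  have hUR : U - 1 = A + (U - 1 - A) := by abel
  have h1 : 1 - nReTr U = (1 / 2) * nhsNormSq (A + (U - 1 - A)) := by
    rw [← hUR, nhsNormSq_sub_one_of_mem_unitaryGroup hU]; ring
  rw [h1, ← mul_sub, abs_mul, abs_of_pos (by norm_num : (0 : ℝ) < 1 / 2)]
  have := abs_nhsNormSq_add_sub_le A (U - 1 - A)
  linarith

/-! ## 2. One variable: `x ↦ 1 − Re tr W(x)` for an analytic germ `W` with `W(0) = 1` and unitary values -/

variable {E : Type*} [NormedAddCommGroup E] [NormedSpace ℝ E]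

/-- Second-order Taylor bound for an analytic germ: `W(x) − W(0) − DW(0)x = O(‖x‖²)`. [folklore] -/
private theorem taylor2_isBigO {𝕜 : Type*} [NontriviallyNormedField 𝕜] {E' F : Type*} [NormedAddCommGroup E']
    [NormedSpace 𝕜 E'] [NormedAddCommGroup F] [NormedSpace 𝕜 F] {W : E' → F} (hW : AnalyticAt 𝕜 W 0) :
    (fun x => W x - W 0 - fderiv 𝕜 W 0 x) =O[𝓝 0] fun x => ‖x‖ ^ 2 := by
  obtain ⟨p, hp⟩ := hW
  refine (hp.isBigO_sub_partialSum_pow 2).congr' (Eventually.of_forall fun y => ?_) EventuallyEq.rfl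
  have hsnoc : (Fin.snoc (0 : Fin 0 → E') y : Fin 1 → E') = fun _ => y := by
    funext i; fin_cases i; rfl
  simp only [FormalMultilinearSeries.partialSum, Finset.sum_range_succ, Finset.sum_range_zero, zero_add,
    hp.fderiv_eq, continuousMultilinearCurryFin1_apply, hp.coeff_zero, hsnoc]
  abel

/-- The one-variable third-order remainder of (2.5): `g₃(x) := [1 − Re tr W(x)] − ½|DW(0)x|²`. [cite: Balaban1987RG1, (2.5) p.266] -/
def rem3 (W : E → Matrix n n ℂ) (x : E) : ℝ :=
  (1 - nReTr (W x)) - (1 / 2) * nhsNormSq (fderiv ℝ W 0 x)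

/-- `Re tr` (normalized trace, (0.2)) as a real continuous linear functional on `M_n(ℂ)`. [cite: Balaban1987RG1, (0.2) p.252] -/
def nReTrL : Matrix n n ℂ →L[ℝ] ℝ where
  toFun := nReTr
  map_add' := nReTr_add'
  map_smul' r X := by
    rw [← Complex.coe_smul, nReTr, nReTr, Matrix.trace_smul, RingHom.id_apply, smul_eq_mul, smul_eq_mul,
      Complex.re_ofReal_mul, mul_div_assoc]
  cont := continuous_nReTr

/-- A matrix entry as a real continuous linear functional on `M_n(ℂ)`. [folklore] -/
private def entryL (i j : n) : Matrix n n ℂ →L[ℝ] ℂ where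
  toFun X := X i j
  map_add' _ _ := rfl
  map_smul' r X := by
    rw [← Complex.coe_smul, Matrix.smul_apply, RingHom.id_apply, smul_eq_mul, Complex.real_smul]
  cont := (continuous_apply j).comp (continuous_apply i)

/-- The `L²` norm square `X ↦ |X|² = (1/n) Σ_{ij} |X_{ij}|²` is real-analytic on `M_n(ℂ)` (a real polynomial in the
entries). [cite: Balaban1985Averaging, (17) p.20] -/
theorem analyticAt_nhsNormSq (X₀ : Matrix n n ℂ) : AnalyticAt ℝ (nhsNormSq : Matrix n n ℂ → ℝ) X₀ := by
  have hfun : (nhsNormSq : Matrix n n ℂ → ℝ) = fun X => (Fintype.card n : ℝ)⁻¹ *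
      ∑ i, ∑ j, ((entryL i j X).re * (entryL i j X).re + (entryL i j X).im * (entryL i j X).im) := by
    funext X
    rw [nhsNormSq, div_eq_inv_mul]
    congr 1
    refine Finset.sum_congr rfl fun i _ => Finset.sum_congr rfl fun j _ => ?_
    rw [Complex.sq_norm, Complex.normSq_apply]
    rfl
  rw [hfun]
  refine analyticAt_const.mul (Finset.analyticAt_fun_sum _ fun i _ => Finset.analyticAt_fun_sum _ fun j _ => ?_)
  have hre := (Complex.reCLM.comp (entryL i j)).analyticAt X₀
  have him := (Complex.imCLM.comp (entryL i j)).analyticAt X₀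
  exact (hre.mul hre).add (him.mul him)

/-- The remainder `g₃` is real-analytic at `0` when the germ `W` is («G₃(B′) is an analytic function of B′»).
[cite: Balaban1987RG1, (2.5) p.266] -/
theorem rem3_analyticAt {W : E → Matrix n n ℂ} (hW : AnalyticAt ℝ W 0) : AnalyticAt ℝ (rem3 W) 0 := by
  unfold rem3
  refine (analyticAt_const.sub ?_).sub (analyticAt_const.mul ?_)
  · exact (nReTrL (n := n)).analyticAt _ |>.comp hW
  · exact (analyticAt_nhsNormSq _).comp ((fderiv ℝ W 0).analyticAt 0)

/-- The remainder `g₃` is of third order («with an expansion beginning with third order terms»): for a real-analytic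
germ `W` at `0` with `W(0) = 1` and unitary values near `0`, `g₃(x) = O(‖x‖³)` as `x → 0` (`W(x) − 1 = DW(0)x + R(x)`,
`R = O(‖x‖²)`, `DW(0)x = O(‖x‖)`, and § 1). [cite: Balaban1987RG1, (2.5) p.266] -/
theorem rem3_isBigO [Nonempty n] {W : E → Matrix n n ℂ} (hW : AnalyticAt ℝ W 0) (hW0 : W 0 = 1)
    (hU : ∀ᶠ x in 𝓝 0, W x ∈ Matrix.unitaryGroup n ℂ) :
    rem3 W =O[𝓝 0] fun x => ‖x‖ ^ 3 := by
  set A : E → Matrix n n ℂ := fun x => fderiv ℝ W 0 x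
  set R : E → Matrix n n ℂ := fun x => W x - 1 - A x
  have hR : R =O[𝓝 0] fun x => ‖x‖ ^ 2 := by simpa only [R, A, hW0] using taylor2_isBigO hW
  have hA : (fun x => ‖A x‖) =O[𝓝 0] fun x => ‖x‖ :=
    ((fderiv ℝ W 0).isBigO_id (𝓝 0)).norm_left.norm_right
  have hpt : ∀ᶠ x in 𝓝 0, ‖rem3 W x‖ ≤ 1 * ‖(‖A x‖ * ‖R x‖ + ‖R x‖ ^ 2 / 2)‖ := by
    filter_upwards [hU] with x hx
    rw [one_mul, Real.norm_eq_abs, Real.norm_of_nonneg (by positivity)]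
    exact abs_one_sub_nReTr_sub_half_nhsNormSq_le hx (A x)
  refine (IsBigO.of_bound 1 hpt).trans ?_
  have h1 : (fun x => ‖A x‖ * ‖R x‖) =O[𝓝 0] fun x => ‖x‖ ^ 3 :=
    (hA.mul hR.norm_left).congr_right fun x => by ring
  have h4 : (fun x : E => ‖x‖ ^ 4) =O[𝓝 0] fun x => ‖x‖ ^ 3 := by
    refine IsBigO.of_bound 1 ?_
    filter_upwards [Metric.ball_mem_nhds (0 : E) one_pos] with x hx
    rw [Metric.mem_ball, dist_zero_right] at hx
    rw [Real.norm_of_nonneg (by positivity), Real.norm_of_nonneg (by positivity), one_mul, pow_succ]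
    exact mul_le_of_le_one_right (by positivity) hx.le
  have h2 : (fun x => ‖R x‖ ^ 2 / 2) =O[𝓝 0] fun x => ‖x‖ ^ 3 := by
    have h' : (fun x => ‖R x‖ ^ 2) =O[𝓝 0] fun x => ‖x‖ ^ 4 :=
      (hR.norm_left.pow 2).congr_right fun x => by ring
    exact ((h'.trans h4).const_mul_left (1 / 2)).congr_left fun x => by ring
  exact h1.add h2

/-- Locality of the remainder: if the germ `W` factors through a continuous linear map `π` (`W = W ∘ π`, e.g. the
restriction of `B′` to the bonds of one block) and is differentiable at `0`, then `g₃ = g₃ ∘ π`. [cite: Balaban1987RG1, (2.5) p.266] -/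
theorem rem3_local {W : E → Matrix n n ℂ} (π : E →L[ℝ] E) (hWπ : ∀ x, W x = W (π x))
    (hW : DifferentiableAt ℝ W 0) (x : E) : rem3 W x = rem3 W (π x) := by
  have hfπ : W ∘ π = W := funext fun x => (hWπ x).symm
  have h1 : HasFDerivAt (W ∘ π) ((fderiv ℝ W 0).comp π) 0 := by
    have hg : HasFDerivAt W (fderiv ℝ W 0) (π 0) := by rw [map_zero]; exact hW.hasFDerivAt
    exact hg.comp 0 π.hasFDerivAt
  rw [hfπ] at h1
  have hD : fderiv ℝ W 0 x = fderiv ℝ W 0 (π x) := by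
    conv_lhs => rw [h1.fderiv]
    rfl
  unfold rem3
  rw [← hWπ x, hD]

/-! ## 3. The display (2.5) over the lattice vocabulary `Setup` -/

variable {P : Params} {k : ℕ} {G : Type*} [GaugeGroup G]

/-- p. 266: *«The variables Ṽ′(y, x) = (V′V⁽ᵏ⁾)(y, x) (V⁽ᵏ⁾(y, x))⁻¹»* as functions of the new variable `B′`
(`pert B′ = V′V⁽ᵏ⁾`; `cd.holTo U y x = U(y, x)` the averaged contour variables (0.11)). [cite: Balaban1987RG1, (2.5) p.266] -/
def tildeV (cd : ContourData P k G) (Vk : GaugeField P k G) (pert : E → GaugeField P k G) (B' : E)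
    (y : Site P (k+1)) (x : Site P k) : G :=
  cd.holTo (pert B') y x * (cd.holTo Vk y x)⁻¹

/-- p. 266: *«Ṽ′(y, x) = 1 + B̃′(y, x) + …, where B̃′(y, x) is a linear function»* — `B̃′(y, x)`, typed as the Fréchet
derivative at `B′ = 0` of `B′ ↦ ρ(Ṽ′(y, x)(B′))` in the unitary matrix realisation `ρ`. [cite: Balaban1987RG1, (2.5) p.266] -/
def Btilde (ρ : G →* Matrix n n ℂ) (cd : ContourData P k G) (Vk : GaugeField P k G) (pert : E → GaugeField P k G)
    (y : Site P (k+1)) (x : Site P k) : E →L[ℝ] Matrix n n ℂ :=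
  fderiv ℝ (fun B' => ρ (tildeV cd Vk pert B' y x)) 0

/-- (2.5): the quadratic part `G⁽²⁾(B′) = Σ_{y∈Y} Σ_{x∈B(y), x≠y} |B̃′(y, x)B′|²` (`|·|` the `L²` matrix norm of
(0.14); `Y = T⁽ᵏ⁺¹⁾` in print, kept general as in `Setup.gaugeFixFn`). [cite: Balaban1987RG1, (2.5) p.266] -/
def G2 (ρ : G →* Matrix n n ℂ) (cd : ContourData P k G) (Vk : GaugeField P k G) (pert : E → GaugeField P k G)
    (Y : Finset (Site P (k+1))) (B' : E) : ℝ :=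
  ∑ y ∈ Y, ∑ x ∈ (block y).erase (emb y), nhsNormSq (Btilde ρ cd Vk pert y x B')

/-- (2.5): the block term `G₃,y(B′) = Σ_{x∈B(y), x≠y} g₃(y, x)(B′)` of `G₃`, `g₃(y, x)(B′) = [1 − Re tr Ṽ′(y, x)(B′)]
− ½|B̃′(y, x)B′|²` («localized in blocks of the lattice T⁽ᵏ⁾»). [cite: Balaban1987RG1, (2.5) p.266] -/
def G3block (ρ : G →* Matrix n n ℂ) (cd : ContourData P k G) (Vk : GaugeField P k G)
    (pert : E → GaugeField P k G) (y : Site P (k+1)) (B' : E) : ℝ :=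
  ∑ x ∈ (block y).erase (emb y), rem3 (fun B'' => ρ (tildeV cd Vk pert B'' y x)) B'

/-- (2.5): `G₃(B′) = Σ_{y∈Y} G₃,y(B′)`, the third-order part of the gauge-fixing term (block sum). [cite: Balaban1987RG1, (2.5) p.266] -/
def G3 (ρ : G →* Matrix n n ℂ) (cd : ContourData P k G) (Vk : GaugeField P k G) (pert : E → GaugeField P k G)
    (Y : Finset (Site P (k+1))) (B' : E) : ℝ :=
  ∑ y ∈ Y, G3block ρ cd Vk pert y B'

section Display

variable (ρ : G →* Matrix n n ℂ) (cd : ContourData P k G) (Vk : GaugeField P k G) (pert : E → GaugeField P k G)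

omit [DecidableEq n] in
/-- A site of `B(y) ∖ {y}` lies in the block of `y` and is not its centre. [cite: Balaban1987RG1, (0.1) p.252] -/
private lemma blockOf_of_mem_erase {y : Site P (k+1)} {x : Site P k} (hx : x ∈ (block y).erase (emb y)) :
    blockOf x = y ∧ x ≠ emb y := by
  rw [Finset.mem_erase, block, Finset.mem_filter] at hx
  exact ⟨hx.2.2, hx.1⟩

/-- **(2.5)** p. 266, the identity: in a unitary matrix realisation `ρ` of `reTr`, for `V⁽ᵏ⁾` in the block axial
gauge (`Setup.AxialGauge`; p. 265 «the axial gauge conditions G(V) = 0», cf. `gaugeFixFn_eq_zero_iff_axialGauge`):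
`G(V′V⁽ᵏ⁾) = ½G⁽²⁾(B′) + G₃(B′)` with `G = Setup.gaugeFixFn cd Y`, `V′V⁽ᵏ⁾ = pert B′`. [cite: Balaban1987RG1, (2.5) p.266] -/
theorem eq25 (hρtr : ∀ g : G, reTr g = nReTr (ρ g)) (hax : AxialGauge cd Vk) (Y : Finset (Site P (k+1)))
    (B' : E) : gaugeFixFn cd Y (pert B') = (1 / 2) * G2 ρ cd Vk pert Y B' + G3 ρ cd Vk pert Y B' := by
  unfold gaugeFixFn G2 G3 G3block rem3 Btilde
  beta_reduce
  rw [Finset.mul_sum, ← Finset.sum_add_distrib]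
  refine Finset.sum_congr rfl fun y _ => ?_
  rw [Finset.mul_sum, ← Finset.sum_add_distrib]
  refine Finset.sum_congr rfl fun x hx => ?_
  obtain ⟨hblk, hne⟩ := blockOf_of_mem_erase hx
  have htv : tildeV cd Vk pert B' y x = cd.holTo (pert B') y x := by
    rw [tildeV, hax y x hblk hne, inv_one, mul_one]
  rw [hρtr, htv]
  ring

/-- **(2.5)**, analyticity clause: *«The function G₃(B′) is an analytic function of B′»*, given that the variables
`Ṽ′(y, x)` are («have an expansion of the form Ṽ′(y, x) = 1 + B̃′(y, x) + …»). [cite: Balaban1987RG1, (2.5) p.266] -/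
theorem G3_analyticAt (Y : Finset (Site P (k+1)))
    (han : ∀ y ∈ Y, ∀ x ∈ (block y).erase (emb y), AnalyticAt ℝ (fun B' => ρ (tildeV cd Vk pert B' y x)) 0) :
    AnalyticAt ℝ (G3 ρ cd Vk pert Y) 0 :=
  Finset.analyticAt_fun_sum _ fun y hy => Finset.analyticAt_fun_sum _ fun x hx => rem3_analyticAt (han y hy x hx)

/-- **(2.5)**, order clause: *«with an expansion beginning with third order terms»* — `G₃(B′) = O(‖B′‖³)` as
`B′ → 0`, for unitary-valued `ρ`, `pert 0 = V⁽ᵏ⁾` and analytic variables `Ṽ′(y, x)`. [cite: Balaban1987RG1, (2.5) p.266] -/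
theorem G3_isBigO [Nonempty n] (hρU : ∀ g : G, ρ g ∈ Matrix.unitaryGroup n ℂ) (hpert0 : pert 0 = Vk)
    (Y : Finset (Site P (k+1)))
    (han : ∀ y ∈ Y, ∀ x ∈ (block y).erase (emb y), AnalyticAt ℝ (fun B' => ρ (tildeV cd Vk pert B' y x)) 0) :
    G3 ρ cd Vk pert Y =O[𝓝 0] fun B' => ‖B'‖ ^ 3 :=
  IsBigO.sum fun y hy => IsBigO.sum fun x hx =>
    rem3_isBigO (han y hy x hx) (by simp [tildeV, hpert0]) (Eventually.of_forall fun B' => hρU _)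

/-- **(2.5)**, locality clause: *«localized in blocks of the lattice T⁽ᵏ⁾»* — the block term `G₃,y` depends on `B′`
only through `πB′` whenever the variables `Ṽ′(y, x)`, `x ∈ B(y)`, do (`π` a continuous linear map, e.g. the
restriction of a bond function to the bonds of `B(y)`; the variables differentiable at `0`, as under `han`).
[cite: Balaban1987RG1, (2.5) p.266] -/
theorem G3block_local (y : Site P (k+1)) (π : E →L[ℝ] E)
    (hπ : ∀ x ∈ (block y).erase (emb y), ∀ B' : E, tildeV cd Vk pert B' y x = tildeV cd Vk pert (π B') y x)
    (hdiff : ∀ x ∈ (block y).erase (emb y), DifferentiableAt ℝ (fun B' => ρ (tildeV cd Vk pert B' y x)) 0)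
    (B' : E) : G3block ρ cd Vk pert y B' = G3block ρ cd Vk pert y (π B') :=
  Finset.sum_congr rfl fun x hx => rem3_local π (fun B'' => congrArg ρ (hπ x hx B'')) (hdiff x hx) B'

/-- **(2.5)** p. 266, bundled: under the unitary matrix realisation `ρ` of `reTr`, the axial gauge of `V⁽ᵏ⁾`,
`V′V⁽ᵏ⁾ = V⁽ᵏ⁾` at `B′ = 0`, and analyticity of the variables `Ṽ′(y, x)` at `B′ = 0`:
`G(V′V⁽ᵏ⁾) = ½G⁽²⁾(B′) + G₃(B′)` for all `B′`, `G₃` analytic at `0`, and `G₃ = O(‖B′‖³)`. [cite: Balaban1987RG1, (2.5) p.266] -/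
theorem eq25_expansion [Nonempty n] (hρU : ∀ g : G, ρ g ∈ Matrix.unitaryGroup n ℂ)
    (hρtr : ∀ g : G, reTr g = nReTr (ρ g)) (hax : AxialGauge cd Vk) (hpert0 : pert 0 = Vk)
    (Y : Finset (Site P (k+1)))
    (han : ∀ y ∈ Y, ∀ x ∈ (block y).erase (emb y), AnalyticAt ℝ (fun B' => ρ (tildeV cd Vk pert B' y x)) 0) :
    (∀ B' : E, gaugeFixFn cd Y (pert B') = (1 / 2) * G2 ρ cd Vk pert Y B' + G3 ρ cd Vk pert Y B') ∧
      AnalyticAt ℝ (G3 ρ cd Vk pert Y) 0 ∧ G3 ρ cd Vk pert Y =O[𝓝 0] fun B' => ‖B'‖ ^ 3 :=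
  ⟨eq25 ρ cd Vk pert hρtr hax Y, G3_analyticAt ρ cd Vk pert Y han, G3_isBigO ρ cd Vk pert hρU hpert0 Y han⟩

omit [DecidableEq n] in
/-- The `L²` norm square vanishes only at `0`. [cite: Balaban1985Averaging, (17) p.20] -/
private lemma eq_zero_of_nhsNormSq_eq_zero [Nonempty n] {X : Matrix n n ℂ} (h : nhsNormSq X = 0) :
    X = 0 := by
  have hc : (Fintype.card n : ℝ) ≠ 0 := Nat.cast_ne_zero.mpr Fintype.card_ne_zero
  rw [nhsNormSq, div_eq_zero_iff, or_iff_left hc] at h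
  ext i j
  have hi := (Finset.sum_eq_zero_iff_of_nonneg fun i _ => Finset.sum_nonneg fun j _ => sq_nonneg _).mp h i
    (Finset.mem_univ _)
  simpa using (Finset.sum_eq_zero_iff_of_nonneg fun j _ => sq_nonneg _).mp hi j (Finset.mem_univ _)

/-- p. 265: *«choosing the element of the orbit satisfying the axial gauge conditions G(V) = 0»* — in a FAITHFUL
unitary matrix realisation `ρ`, `G(V) = 0` (sum over all of `T⁽ᵏ⁺¹⁾`) iff `V` is in the block axial gauge
`V(y, x) = 1`, `x ∈ B(y)`, `x ≠ y` (`Setup.AxialGauge`): each term `1 − Re tr V(y, x) = ½|V(y, x) − 1|² ≥ 0` vanishes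
iff `V(y, x) = 1`. [cite: Balaban1987RG1, (2.2) p.265] -/
theorem gaugeFixFn_eq_zero_iff_axialGauge [Nonempty n] (hρU : ∀ g : G, ρ g ∈ Matrix.unitaryGroup n ℂ)
    (hρtr : ∀ g : G, reTr g = nReTr (ρ g)) (hρinj : Function.Injective ρ) (V : GaugeField P k G) :
    gaugeFixFn cd Finset.univ V = 0 ↔ AxialGauge cd V := by
  have hnn : ∀ y, ∀ x ∈ (block y).erase (emb y), 0 ≤ 1 - reTr (cd.holTo V y x) :=
    fun y x _ => sub_nonneg.mpr (GaugeGroup.reTr_le_one _)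
  constructor
  · intro h y x hblk hne
    have hx : x ∈ (block y).erase (emb y) := by
      rw [Finset.mem_erase, block, Finset.mem_filter]
      exact ⟨hne, Finset.mem_univ _, hblk⟩
    rw [gaugeFixFn, Finset.sum_eq_zero_iff_of_nonneg fun y _ => Finset.sum_nonneg (hnn y)] at h
    have h1 := (Finset.sum_eq_zero_iff_of_nonneg (hnn y)).mp (h y (Finset.mem_univ _)) x hx
    rw [hρtr] at h1
    have h2 : nhsNormSq (ρ (cd.holTo V y x) - 1) = 0 := by
      rw [nhsNormSq_sub_one_of_mem_unitaryGroup (hρU _), h1, mul_zero]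
    have h3 : ρ (cd.holTo V y x) = ρ 1 := by
      rw [map_one]; exact sub_eq_zero.mp (eq_zero_of_nhsNormSq_eq_zero h2)
    exact hρinj h3
  · intro h
    refine Finset.sum_eq_zero fun y _ => Finset.sum_eq_zero fun x hx => ?_
    obtain ⟨hblk, hne⟩ := blockOf_of_mem_erase hx
    rw [h y x hblk hne, GaugeGroup.reTr_one, sub_self]

end Display

/-! ## 4. The cell's instances `G = U(n)`, `SU(n)` (`UnitaryModel`): the realisation hypotheses are `rfl` -/

section Instances

open Literature.MathematicalPhysics.QuantumLattice

variable [Nonempty n]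

/-- (2.5) for `G = U(n)` with the cell's `GaugeGroup` instance (`reTr U = Re tr U`; `ρ` = the inclusion
`unitaryFundamentalRep`): the identity for axial `V⁽ᵏ⁾`, analyticity and third order of `G₃`, for analytic
variables `Ṽ′(y, x)`. [cite: Balaban1987RG1, (2.5) p.266] -/
theorem eq25_expansion_unitaryGroup (cd : ContourData P k (Matrix.unitaryGroup n ℂ))
    (Vk : GaugeField P k (Matrix.unitaryGroup n ℂ)) (pert : E → GaugeField P k (Matrix.unitaryGroup n ℂ))
    (hax : AxialGauge cd Vk) (hpert0 : pert 0 = Vk) (Y : Finset (Site P (k+1)))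
    (han : ∀ y ∈ Y, ∀ x ∈ (block y).erase (emb y),
      AnalyticAt ℝ (fun B' => unitaryFundamentalRep n ℂ (tildeV cd Vk pert B' y x)) 0) :
    (∀ B' : E, gaugeFixFn cd Y (pert B') =
        (1 / 2) * G2 (unitaryFundamentalRep n ℂ) cd Vk pert Y B' + G3 (unitaryFundamentalRep n ℂ) cd Vk pert Y B') ∧
      AnalyticAt ℝ (G3 (unitaryFundamentalRep n ℂ) cd Vk pert Y) 0 ∧
      G3 (unitaryFundamentalRep n ℂ) cd Vk pert Y =O[𝓝 0] fun B' => ‖B'‖ ^ 3 :=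
  eq25_expansion (unitaryFundamentalRep n ℂ) cd Vk pert (fun U => U.2) (fun _ => rfl) hax hpert0 Y han

/-- (2.5) for `G = SU(n)` with the cell's `GaugeGroup` instance (`ρ = fundamentalRep`). [cite: Balaban1987RG1, (2.5) p.266] -/
theorem eq25_expansion_specialUnitaryGroup (cd : ContourData P k (Matrix.specialUnitaryGroup n ℂ))
    (Vk : GaugeField P k (Matrix.specialUnitaryGroup n ℂ))
    (pert : E → GaugeField P k (Matrix.specialUnitaryGroup n ℂ))
    (hax : AxialGauge cd Vk) (hpert0 : pert 0 = Vk) (Y : Finset (Site P (k+1)))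
    (han : ∀ y ∈ Y, ∀ x ∈ (block y).erase (emb y),
      AnalyticAt ℝ (fun B' => fundamentalRep n (tildeV cd Vk pert B' y x)) 0) :
    (∀ B' : E, gaugeFixFn cd Y (pert B') =
        (1 / 2) * G2 (fundamentalRep n) cd Vk pert Y B' + G3 (fundamentalRep n) cd Vk pert Y B') ∧
      AnalyticAt ℝ (G3 (fundamentalRep n) cd Vk pert Y) 0 ∧
      G3 (fundamentalRep n) cd Vk pert Y =O[𝓝 0] fun B' => ‖B'‖ ^ 3 :=
  eq25_expansion (fundamentalRep n) cd Vk pert fundamentalRep_mem_unitaryGroup (fun _ => rfl) hax hpert0 Y han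

end Instances

end

end Literature.MathematicalPhysics.QuantumFieldTheory.Balaban1983to89.B12GaugeFixExpansion25
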